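import Mathlib
import HarnessLib.Audit
import Summits.PneNP.PneNP.Theorems.PstarLitNorCore
import Summits.PneNP.PneNP.Theorems.PstarGapTwoAssembly

/-!
# The core-shape conjecture: CoreBound = classification + accounting (ROUND-24, GAPTWO-PLAN v1.1; planner seat p3 g20)

FRONTIER range-avoidance ladder, rung F-N3, ROUND 24 (cell `pnp-ideate`; restricted-model proof complexity — nothing here bears on
`P` versus `NP`).

Memo `CORE-BOUND-NOTES.md` §11–§12.  The h = 2 rung `GapTwo` is equivalent to `CoreBound` (`PstarGapTwoAssembly.gapTwo_iff_coreBound`).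
This file splits `CoreBound` into two named conjectures whose conjunction implies it:

* `core I J` — the XOR 2-core of `J`: the union of all XOR-closed subsets of `J` (itself XOR-closed and the largest one, by
  `PstarCoreBound.xorClosed_union`);
* `CoreShape` (CLASSIFICATION, conjecture C6 of the memo): for a minimal infeasible `J` under at most two parity constraints on an admissible
  instance, the core has at most `3` outputs or carries a `LitNorStructure` (`PstarLitNorCore`) whose reader `g₀` lies in `J` outside the core.
  Evidence: every minimal infeasible admissible configuration produced by the cell's engines (kit K11/K12/K13, and the basis-free engine K15/K16 of
  memo §11, which finds hundreds per core-minute) has a core of size `3` or `5` and classifies as `LitNorStructure` with `g₀` one of its read pendants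
  — including the "pin + gate" cores of `PstarLitGateCore`, whose literal pair is the gate reader's own AND pair;
* `LitNorCoreBound` (ACCOUNTING, `PstarLitNorCore`, typed earlier today): such a core has at most `5` outputs;
* `coreBound_of_coreShape` : `CoreShape → LitNorCoreBound → CoreBound` (with `K₀ = 5` for every `Δ`), hence
  `gapTwo_of_coreShape : CoreShape → LitNorCoreBound → GapTwo`.

So the rung is reduced to C6 + the literal-path accounting lemma.  C6 is where the algebra lives (memo §10–§11: cycle-equation variety, forcing only on
zero-literal flats of codimension `2`, rank rigidity `PstarRankRigidity`); the accounting lemma is pure expansion combinatorics.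
-/

set_option linter.dupNamespace false

open Finset Literature.Computability.Complexity
open Summit.PneNP.PneNP.Theorems.PstarTyped (Typed)
open Summit.PneNP.PneNP.Theorems.PstarSALevel (varSet bdry BoundaryExpanding SimpleOverlap)
open Summit.PneNP.PneNP.Theorems.PstarGapLemma (MinInfeasible MaxDegree)
open Summit.PneNP.PneNP.Theorems.PstarGapTwo (GapTwo)
open Summit.PneNP.PneNP.Theorems.PstarCoreBound (XorClosed CoreBound xorClosed_empty xorClosed_union)
open Summit.PneNP.PneNP.Theorems.PstarLitNorCore (LitNorStructure LitNorCoreBound)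
open Summit.PneNP.PneNP.Theorems.PstarGapTwoAssembly (gapTwo_of_coreBound)

namespace Summit.PneNP.PneNP.Theorems.PstarCoreShape

variable {n m : ℕ}

/-- The XOR 2-core of `J`: the union of all XOR-closed subsets of `J`. -/
noncomputable def core (I : LocalMap 4 n m) (J : Finset (Fin m)) : Finset (Fin m) := by
  classical exact ((J.powerset.filter fun J₀ => XorClosed I J₀).sup id)

/-- The core is a subset of `J`. -/
theorem core_subset (I : LocalMap 4 n m) (J : Finset (Fin m)) : core I J ⊆ J := by
  classical
  unfold core
  refine Finset.sup_le ?_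
  intro J₀ h
  simpa using (Finset.mem_filter.1 h).1

/-- Every XOR-closed subset of `J` lies in the core. -/
theorem subset_core (I : LocalMap 4 n m) {J J₀ : Finset (Fin m)} (hJ : J₀ ⊆ J) (hX : XorClosed I J₀) : J₀ ⊆ core I J := by
  classical
  unfold core
  have hmem : J₀ ∈ J.powerset.filter fun J₀ => XorClosed I J₀ := Finset.mem_filter.2 ⟨Finset.mem_powerset.2 hJ, hX⟩
  exact Finset.le_sup (f := id) hmem

/-- The core is XOR-closed (finite `sup` of XOR-closed sets, by `xorClosed_union`). -/
theorem xorClosed_core (I : LocalMap 4 n m) (J : Finset (Fin m)) : XorClosed I (core I J) := by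
  classical
  unfold core
  refine Finset.sup_induction (p := fun S => XorClosed I S) (xorClosed_empty I) ?_ ?_
  · intro a ha b hb
    exact xorClosed_union I ha hb
  · intro J₀ h
    simpa using (Finset.mem_filter.1 h).2

/-- An XOR-closed `J` is its own core. -/
theorem core_eq_self (I : LocalMap 4 n m) {J : Finset (Fin m)} (hX : XorClosed I J) : core I J = J :=
  Finset.Subset.antisymm (core_subset I J) (subset_core I (Finset.Subset.refl J) hX)

/-- **Conjecture C6 — CORE SHAPE (classification; OPEN).**  The core of a minimal infeasible output set under at most two parity constraints, on an
expanding typed pure `P⋆` instance with simple overlaps and bounded variable degree, has at most `3` outputs or carries a `LitNorStructure` whose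
reader lies in `J` outside the core.  FRONTIER. -/
@[conjecture] def CoreShape : Prop :=
  ∀ (Δ n m r : ℕ) (I : LocalMap 4 n m), I.IsPure xorAndPred → Typed I → BoundaryExpanding r I → SimpleOverlap I → MaxDegree Δ I →
    ∀ (y : Fin m → Bool) (W : Finset (Finset (Fin n) × Bool)) (J : Finset (Fin m)),
      W.card ≤ 2 → J.card ≤ r → MinInfeasible I y W J →
        (core I J).card ≤ 3 ∨ ∃ σ τ : Fin n, ∃ g₀ ∈ J \ core I J, LitNorStructure I (core I J) σ τ g₀

/-- **CoreBound from classification + accounting**, with the absolute constant `K₀ = 5`. -/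
theorem coreBound_of_coreShape (h₁ : CoreShape) (h₂ : LitNorCoreBound) : CoreBound := by
  intro Δ
  refine ⟨5, ?_⟩
  intro n m r I hP hT hB hS hD y W J hW hJ hM J₀ hJ₀ hX
  have hsub : J₀ ⊆ core I J := subset_core I hJ₀ hX
  have hcard : (core I J).card ≤ 5 := by
    rcases h₁ Δ n m r I hP hT hB hS hD y W J hW hJ hM with h3 | ⟨σ, τ, g₀, hg₀, hL⟩
    · omega
    · have hss : core I J ⊂ J := by
        refine Finset.ssubset_iff_subset_ne.2 ⟨core_subset I J, ?_⟩
        intro h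
        rw [h] at hg₀
        simp at hg₀
      have hlt : (core I J).card < r := lt_of_lt_of_le (Finset.card_lt_card hss) hJ
      exact h₂ n m r I hP hB hS (core I J) σ τ g₀ hlt (xorClosed_core I J) hL
  exact le_trans (Finset.card_le_card hsub) hcard

/-- **The h = 2 rung from C6 + the accounting lemma.** -/
theorem gapTwo_of_coreShape (h₁ : CoreShape) (h₂ : LitNorCoreBound) : GapTwo :=
  gapTwo_of_coreBound (coreBound_of_coreShape h₁ h₂)

end Summit.PneNP.PneNP.Theorems.PstarCoreShape
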